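import Summits.NavierStokesRegularity.NavierStokesRegularity.Theses.TypeILiouville
import Literature.Analysis.FluidPDE.KNSSWeakDriftMildProofs
import Literature.Analysis.FluidPDE.OseenMildWindowRepresentative
import Literature.Analysis.FluidPDE.KNSSRegularityGluing
import Literature.Analysis.FluidPDE.KNSSOseenMildDecayTools
import Literature.Analysis.FluidPDE.AncientMildWeak
import Literature.Analysis.UnboundedOperators.HeatKernelBoundedData
import HarnessLib

/-!
# Route TypeILiouville — `TypeIliouvilleL`, stub A: the ancient drift-mild decomposition

Support file for item stmt-NavierStokesRegularity-10661 (`TypeIliouvilleL`, the KNSS Liouville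
conjecture (L)) of route `TypeILiouville` (problem `NavierStokesRegularity`).

**Main result** (`stub_weak_ancient_driftMild`). A bounded ancient mild solution of Navier–Stokes
(`ν = 1`, duality form) which is jointly strongly measurable is a bounded weak solution on
`ℝ³ × (−∞, 0)` (`IsBoundedAncientMildSolution.isBoundedWeakNSSolutionOn`), hence — Koch–
Nadirashvili–Seregin–Šverák 2009, Lemma 3.1 in drift-mild form on the windows `(−(n+1), 0)`
(`window_decomposition`: `KNSS2009_weak_driftMild_holds` after a time shift, normalised by
`V(−1/2, 0) = 0`; `(V + κ, β − κ)` is again drift-mild, `isKNSSDriftMild_add_const`), glued along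
`(−∞, 0)` by Remark 3.1 (`overlap_eq`: two drift-mild decompositions `(V, β)`, `(V', β')` of the
same velocity on a window differ by ONE constant — `D = V' − V` is jointly continuous and
`D(t, ·)` is a.e. constant for a.e. `t`, so `D(t, x) = γ(t)`; the drift-Duhamel terms coincide,
`driftDuhamel_congr_ae`, so `γ(t) = e^{(t−s)Δ}γ(s) = γ(s)`) — `u(t) = U(t) + b(t)` a.e. in `x`
for a.e. `t < 0` with `U(t) = V_{⌊−t⌋}(t)`, `b(t) = β_{⌊−t⌋}(t)`: `U` jointly measurable,
continuous on `(−∞, 0) × ℝ³`, weakly divergence free at every `t < 0`, `U, b` bounded on every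
`(T, 0)`, and `U(t) = e^{(t−s)Δ}U(s) − ∫ₛᵗ e^{(t−σ)Δ}P∇·((U+b) ⊗ (U+b)) dσ` for all `s < t < 0`.

## References

* G. Koch, N. Nadirashvili, G. Seregin, V. Šverák, *Liouville theorems for the Navier–Stokes
  equations and applications*, Acta Math. 203 (2009) 83–105 = arXiv:0709.3599v1, §3 Lemma 3.1
  and Remark 3.1, §4 (ii). [KochNadirashviliSereginSverak2009]
-/

set_option linter.dupNamespace false

noncomputable section

namespace Summit.NavierStokesRegularity.NavierStokesRegularity.Theorems

open MeasureTheory Filter Set Function Metric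
open scoped Topology ENNReal
open Literature.Analysis Literature.Analysis.FluidPDE

namespace TypeIliouvilleL.WeakAncientDriftMild

/-- **Time translation of the drift-Duhamel term**: translating `U` and `b` in time by `c`
translates `driftDuhamel` (the substitution `σ ↦ σ + c` in the outer time integral). -/
theorem driftDuhamel_comp_add_right (U : ℝ → EuclideanSpace ℝ (Fin 3) → EuclideanSpace ℝ (Fin 3))
    (b : ℝ → EuclideanSpace ℝ (Fin 3)) (c s t : ℝ) (x : EuclideanSpace ℝ (Fin 3)) :
    driftDuhamel (fun τ y => U (τ + c) y) (fun τ => b (τ + c)) s t x =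
      driftDuhamel U b (s + c) (t + c) x := by
  rw [driftDuhamel_apply, driftDuhamel_apply]
  set g : ℝ → EuclideanSpace ℝ (Fin 3) := fun σ => ∑ i,
    oseenHeat (t + c - σ) (driftTensor U b σ) i x •
      stdOrthonormalBasis ℝ (EuclideanSpace ℝ (Fin 3)) i with hg
  have hT : ∀ σ, driftTensor (fun τ y => U (τ + c) y) (fun τ => b (τ + c)) σ =
      driftTensor U b (σ + c) := fun σ => by
    funext j k y
    simp only [driftTensor_apply]
  have e : (fun σ => ∑ i, oseenHeat (t - σ)
      (driftTensor (fun τ y => U (τ + c) y) (fun τ => b (τ + c)) σ) i x •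
        stdOrthonormalBasis ℝ (EuclideanSpace ℝ (Fin 3)) i) = fun σ => g (σ + c) := by
    funext σ
    simp only [hg, hT, add_sub_add_right_eq_sub]
  rw [e, intervalIntegral.integral_comp_add_right g c]

/-- **A drift-mild pair shifted by a constant is drift-mild**: if `(U, b)` is drift-mild on
`(0, T)` with bound `N` and `‖κ‖ ≤ N`, then so is `(U + κ, b − κ)` with bound `N + N` (the full
velocity `U + b`, hence the drift-Duhamel term, is unchanged; `e^{τΔ}(U(s) + κ) = e^{τΔ}U(s) + κ`;
constants are weakly divergence free). -/
theorem isKNSSDriftMild_add_const {T N : ℝ}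
    {U : ℝ → EuclideanSpace ℝ (Fin 3) → EuclideanSpace ℝ (Fin 3)} {b : ℝ → EuclideanSpace ℝ (Fin 3)}
    (h : IsKNSSDriftMild T N U b) (κ : EuclideanSpace ℝ (Fin 3)) (hκ : ‖κ‖ ≤ N) :
    IsKNSSDriftMild T (N + N) (fun σ y => U σ y + κ) (fun σ => b σ - κ) where
  measurable_drift := h.measurable_drift.sub_const κ
  norm_drift_le σ := (norm_sub_le _ _).trans (add_le_add (h.norm_drift_le σ) hκ)
  measurable := h.measurable.add_const κ
  norm_le σ hσ y := (norm_add_le _ _).trans (add_le_add (h.norm_le σ hσ y) hκ)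
  ae_isWeaklyDivFree := by
    have hE : Module.finrank ℝ (EuclideanSpace ℝ (Fin 3)) = 3 := finrank_euclideanSpace_fin
    filter_upwards [h.ae_isWeaklyDivFree, ae_restrict_mem measurableSet_Ioo] with σ hσ hσI
    have e1 : (fun y => U σ y + κ) = U σ - fun _ => -κ := by
      funext y
      simp
    show IsWeaklyDivFree (fun y => U σ y + κ)
    rw [e1]
    exact hσ.sub_of_locallyIntegrable (isWeaklyDivFree_const (-κ))
      (h.continuous_slice hE hσI).locallyIntegrable continuous_const.locallyIntegrable
  mild s t hs hst htT x := by
    have hsI : s ∈ Ioo 0 T := ⟨hs, hst.trans htT⟩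
    have hUmeas : Measurable (U s) := h.measurable.comp (measurable_const.prodMk measurable_id)
    have hheat : UnboundedOperators.heatExtension (fun y => U s y + κ) (t - s) x =
        UnboundedOperators.heatExtension (U s) (t - s) x + κ :=
      heatExtension_add_const_apply hUmeas.aestronglyMeasurable (h.norm_le s hsI) κ
        (sub_pos.2 hst) x
    have hdrift : driftDuhamel (fun σ y => U σ y + κ) (fun σ => b σ - κ) s t x =
        driftDuhamel U b s t x :=
      driftDuhamel_congr_ae hst.le (Eventually.of_forall fun σ =>
        Eventually.of_forall fun y => by
          show U σ y + κ + (b σ - κ) = U σ y + b σ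
          abel) x
    show U t x + κ = UnboundedOperators.heatExtension (fun y => U s y + κ) (t - s) x -
      driftDuhamel (fun σ y => U σ y + κ) (fun σ => b σ - κ) s t x
    rw [hheat, hdrift, h.mild s t hs hst htT x]
    abel

/-- Slices of a field jointly continuous on an open time window are continuous. -/
theorem continuous_slice_of_continuousOn {a c : ℝ}
    {V : ℝ → EuclideanSpace ℝ (Fin 3) → EuclideanSpace ℝ (Fin 3)}
    (hVc : ContinuousOn (uncurry V) (Ioo a c ×ˢ univ)) {t : ℝ} (ht : t ∈ Ioo a c) :
    Continuous (V t) :=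
  hVc.comp_continuous (continuous_const.prodMk continuous_id) fun x => ⟨ht, mem_univ x⟩

/-- Time sections of a field jointly continuous on an open time window are continuous there. -/
theorem continuousOn_time_of_continuousOn {a c : ℝ}
    {V : ℝ → EuclideanSpace ℝ (Fin 3) → EuclideanSpace ℝ (Fin 3)}
    (hVc : ContinuousOn (uncurry V) (Ioo a c ×ˢ univ)) (x : EuclideanSpace ℝ (Fin 3)) :
    ContinuousOn (fun τ => V τ x) (Ioo a c) :=
  hVc.comp (f := fun τ : ℝ => (τ, x)) (continuous_id.prodMk continuous_const).continuousOn
    fun _ hτ => ⟨hτ, mem_univ x⟩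

/-- **KNSS 2009, Remark 3.1: two drift-mild decompositions of the same velocity on a window
differ by one constant.** If `(V, β)` and `(V', β')` satisfy the drift-mild identity on `(a, c)`,
`V`, `V'` are jointly continuous there, `V` is bounded, `V + β = V' + β'` a.e. in `x` for a.e.
`t ∈ (a, c)`, and `V(t₀, x₀) = V'(t₀, x₀)` at one point of the window, then `V' = V` on
`(a, c) × ℝ³` (`D = V' − V` is continuous with `D(t, ·)` a.e. constant for a.e. `t`, hence
`D(t, x) = γ(t)`; the drift-Duhamel terms coincide, `driftDuhamel_congr_ae`, so
`γ(t) = e^{(t−s)Δ}γ(s) = γ(s)`, and `γ(t₀) = 0`). -/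
theorem overlap_eq {a c t₀ : ℝ} {x₀ : EuclideanSpace ℝ (Fin 3)}
    {V V' : ℝ → EuclideanSpace ℝ (Fin 3) → EuclideanSpace ℝ (Fin 3)}
    {β β' : ℝ → EuclideanSpace ℝ (Fin 3)} {N : ℝ}
    (hVc : ContinuousOn (uncurry V) (Ioo a c ×ˢ univ))
    (hV'c : ContinuousOn (uncurry V') (Ioo a c ×ˢ univ))
    (hVN : ∀ t ∈ Ioo a c, ∀ x, ‖V t x‖ ≤ N)
    (hmild : ∀ s t : ℝ, a < s → s < t → t < c → ∀ x,
      V t x = UnboundedOperators.heatExtension (V s) (t - s) x - driftDuhamel V β s t x)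
    (hmild' : ∀ s t : ℝ, a < s → s < t → t < c → ∀ x,
      V' t x = UnboundedOperators.heatExtension (V' s) (t - s) x - driftDuhamel V' β' s t x)
    (hae : ∀ᵐ t ∂(volume.restrict (Ioo a c)),
      (fun x => V t x + β t) =ᵐ[volume] fun x => V' t x + β' t)
    (ht₀ : t₀ ∈ Ioo a c) (h₀ : V t₀ x₀ = V' t₀ x₀) :
    ∀ t ∈ Ioo a c, ∀ x, V' t x = V t x := by
  -- (1) for a.e. `t`, `V'(t) − V(t)` is constant in `x`
  have h1 : ∀ᵐ t ∂(volume.restrict (Ioo a c)), ∀ x, V' t x - V t x = V' t 0 - V t 0 := by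
    filter_upwards [hae, ae_restrict_mem measurableSet_Ioo] with t ht htI x
    have e := Measure.eq_of_ae_eq ht
      ((continuous_slice_of_continuousOn hVc htI).add continuous_const)
      ((continuous_slice_of_continuousOn hV'c htI).add continuous_const)
    have ex : V t x + β t = V' t x + β' t := congrFun e x
    have e0 : V t 0 + β t = V' t 0 + β' t := congrFun e 0
    rw [eq_sub_of_add_eq ex.symm, eq_sub_of_add_eq e0.symm]
    abel
  -- (2) for every `t`, by continuity in `t`
  have h2 : ∀ t ∈ Ioo a c, ∀ x, V' t x - V t x = V' t 0 - V t 0 := by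
    intro t ht x
    set g : ℝ → EuclideanSpace ℝ (Fin 3) := fun τ => (V' τ x - V τ x) - (V' τ 0 - V τ 0) with hg
    have hg0 : g =ᵐ[volume.restrict (Ioo a c)] fun _ => (0 : EuclideanSpace ℝ (Fin 3)) := by
      filter_upwards [h1] with τ hτ
      simp only [hg, hτ x, sub_self]
    have hgc : ContinuousOn g (Ioo a c) :=
      (((continuousOn_time_of_continuousOn hV'c x).sub
        (continuousOn_time_of_continuousOn hVc x)).sub
        ((continuousOn_time_of_continuousOn hV'c 0).sub
          (continuousOn_time_of_continuousOn hVc 0)))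
    have h := Measure.eqOn_open_of_ae_eq hg0 isOpen_Ioo hgc continuousOn_const ht
    simp only [hg] at h
    exact sub_eq_zero.1 h
  -- (3) the constant `γ(t) = V'(t, 0) − V(t, 0)` does not depend on `t`
  have h3 : ∀ s t : ℝ, a < s → s < t → t < c → V' t 0 - V t 0 = V' s 0 - V s 0 := by
    intro s t has hst htc
    have hsI : s ∈ Ioo a c := ⟨has, hst.trans htc⟩
    have hD : driftDuhamel V' β' s t 0 = driftDuhamel V β s t 0 :=
      driftDuhamel_congr_ae hst.le (ae_restrict_of_ae_restrict_of_subset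
        (Ioo_subset_Ioo has.le htc.le) (hae.mono fun σ hσ => hσ.symm)) 0
    have e : V' s = fun y => V s y + (V' s 0 - V s 0) := funext fun y => by
      rw [← h2 s hsI y]
      abel
    have hheat : UnboundedOperators.heatExtension (V' s) (t - s) 0 =
        UnboundedOperators.heatExtension (V s) (t - s) 0 + (V' s 0 - V s 0) :=
      (congrArg (fun f : EuclideanSpace ℝ (Fin 3) → EuclideanSpace ℝ (Fin 3) =>
        UnboundedOperators.heatExtension f (t - s) (0 : EuclideanSpace ℝ (Fin 3))) e).trans
        (heatExtension_add_const_apply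
          (continuous_slice_of_continuousOn hVc hsI).aestronglyMeasurable (hVN s hsI) _
          (sub_pos.2 hst) 0)
    rw [hmild s t has hst htc 0, hmild' s t has hst htc 0, hD, hheat]
    abel
  -- (4) `γ(t₀) = 0`, hence `γ = 0` and `V' = V`
  have hγ0 : V' t₀ 0 - V t₀ 0 = 0 := by rw [← h2 t₀ ht₀ x₀, h₀, sub_self]
  intro t ht x
  have hγ : V' t 0 - V t 0 = 0 := by
    rcases lt_trichotomy t t₀ with hlt | heq | hgt
    · rwa [← h3 t t₀ ht.1 hlt ht₀.2]
    · rwa [heq]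
    · rwa [h3 t₀ t ht₀.1 hgt ht.2]
  have h := h2 t ht x
  rw [hγ] at h
  exact sub_eq_zero.1 h

/-- **KNSS 2009, Lemma 3.1 on the window `(−T, 0)`, normalised.** For a bounded weak solution `u`
of Navier–Stokes (`ν = 1`) on `ℝ³ × (−∞, 0)` with `‖u‖ ≤ M` and `T ≥ 1` there are `N ≥ 0`, a field
`V` (jointly measurable, continuous on `(−T, 0) × ℝ³`, bounded by `N` there, weakly divergence
free at every time of the window, `V(−1/2, 0) = 0`) and a measurable drift `β`, `‖β‖ ≤ N`, with
the drift-mild identity for all `−T < s < t < 0` and `u(t) = V(t) + β(t)` a.e. in `x` for a.e.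
`t ∈ (−T, 0)` (`KNSS2009_weak_driftMild_holds` for `u(· − T)` on `(0, T)`,
`isKNSSDriftMild_add_const` with `κ = −U(T − 1/2, 0)`, translation back). -/
theorem window_decomposition {u : ℝ → EuclideanSpace ℝ (Fin 3) → EuclideanSpace ℝ (Fin 3)}
    (hbw : IsBoundedWeakNSSolutionOn (Iio 0) isOpen_Iio 1 u) {M : ℝ}
    (hM : ∀ t ∈ Iio (0 : ℝ), ∀ x, ‖u t x‖ ≤ M) {T : ℝ} (hT : 1 ≤ T) :
    ∃ (N : ℝ) (V : ℝ → EuclideanSpace ℝ (Fin 3) → EuclideanSpace ℝ (Fin 3))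
      (β : ℝ → EuclideanSpace ℝ (Fin 3)),
      0 ≤ N ∧ Measurable (uncurry V) ∧ Measurable β ∧
      ContinuousOn (uncurry V) (Ioo (-T) 0 ×ˢ univ) ∧
      (∀ t ∈ Ioo (-T) 0, ∀ x, ‖V t x‖ ≤ N) ∧ (∀ t, ‖β t‖ ≤ N) ∧
      (∀ t ∈ Ioo (-T) 0, IsWeaklyDivFree (V t)) ∧
      (∀ s t : ℝ, -T < s → s < t → t < 0 → ∀ x,
        V t x = UnboundedOperators.heatExtension (V s) (t - s) x - driftDuhamel V β s t x) ∧
      V (-(1 / 2)) 0 = 0 ∧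
      ∀ᵐ t ∂(volume.restrict (Ioo (-T) 0)), u t =ᵐ[volume] fun x => V t x + β t := by
  have hT0 : 0 < T := by linarith
  have hJI : ∀ τ : ℝ, τ ∈ Ioo 0 T ↔ τ + -T ∈ Ioo (-T) 0 := fun τ => by
    constructor
    · rintro ⟨h1, h2⟩
      exact ⟨by linarith, by linarith⟩
    · rintro ⟨h1, h2⟩
      exact ⟨by linarith, by linarith⟩
  have hbwT : IsBoundedWeakNSSolutionOn (Ioo 0 T) isOpen_Ioo 1 (fun τ => u (τ + -T)) :=
    (hbw.mono isOpen_Ioo Ioo_subset_Iio_self).comp_add_right (-T) isOpen_Ioo hJI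
  have hMT : ∀ τ ∈ Ioo 0 T, ∀ x, ‖u (τ + -T) x‖ ≤ M := fun τ hτ x =>
    hM _ ((hJI τ).1 hτ).2 x
  -- ## Lemma 3.1 on `(0, T)` for the time shift, normalised by `U(T − 1/2, 0) + κ = 0`
  obtain ⟨N, hN⟩ := KNSS2009_weak_driftMild_holds M T hT0
  obtain ⟨U, b, hUb, hae⟩ := hN hbwT hMT
  have hmid : T - 1 / 2 ∈ Ioo 0 T := ⟨by linarith, by linarith⟩
  set κ : EuclideanSpace ℝ (Fin 3) := -U (T - 1 / 2) 0 with hκ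
  have hκN : ‖κ‖ ≤ N := by
    rw [hκ, norm_neg]
    exact hUb.norm_le _ hmid 0
  have h' : IsKNSSDriftMild T (N + N) (fun σ y => U σ y + κ) (fun σ => b σ - κ) :=
    isKNSSDriftMild_add_const hUb κ hκN
  have hsh : ∀ t : ℝ, t ∈ Ioo (-T) 0 → t + T ∈ Ioo 0 T := fun t ht =>
    ⟨by linarith [ht.1], by linarith [ht.2]⟩
  refine ⟨N + N, fun t x => U (t + T) x + κ, fun t => b (t + T) - κ,
    add_nonneg hUb.nonneg hUb.nonneg,
    h'.measurable.comp ((measurable_fst.add_const T).prodMk measurable_snd),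
    h'.measurable_drift.comp (measurable_id.add_const T), ?_,
    fun t ht x => h'.norm_le (t + T) (hsh t ht) x, fun t => h'.norm_drift_le (t + T),
    fun t ht => h'.isWeaklyDivFree_of_mem (hsh t ht), ?_, ?_, ?_⟩
  · -- joint continuity
    refine h'.continuousOn_uncurry.comp
      (f := fun q : ℝ × EuclideanSpace ℝ (Fin 3) => (q.1 + T, q.2))
      ((continuous_fst.add continuous_const).prodMk continuous_snd).continuousOn ?_
    intro q hq
    exact ⟨hsh q.1 hq.1, mem_univ _⟩
  · -- the drift-mild identity, translated back
    intro s t hs hst ht x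
    have hm := h'.mild (s + T) (t + T) (by linarith) (by linarith) (by linarith) x
    have hd := driftDuhamel_comp_add_right (fun σ y => U σ y + κ) (fun σ => b σ - κ) T s t x
    rw [add_sub_add_right_eq_sub] at hm
    show U (t + T) x + κ =
      UnboundedOperators.heatExtension (fun y => U (s + T) y + κ) (t - s) x -
        driftDuhamel (fun τ y => U (τ + T) y + κ) (fun τ => b (τ + T) - κ) s t x
    rw [hd]
    exact hm
  · -- normalisation
    show U (-(1 / 2) + T) 0 + -U (T - 1 / 2) 0 = 0
    rw [show (-(1 / 2) + T : ℝ) = T - 1 / 2 by ring, add_neg_cancel]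
  · -- `u = V + β` a.e.
    have h1 := (ae_restrict_iff' (measurableSet_Ioo (a := (0 : ℝ)) (b := T))).1 hae
    have h2 := (measurePreserving_add_right (volume : Measure ℝ) T).quasiMeasurePreserving.ae h1
    refine (ae_restrict_iff' measurableSet_Ioo).2 (h2.mono fun t ht htI => ?_)
    have h3 : u (t + T + -T) =ᵐ[volume] fun x => U (t + T) x + b (t + T) := ht (hsh t htI)
    rw [add_neg_cancel_right] at h3
    refine h3.trans (Eventually.of_forall fun x => ?_)
    show U (t + T) x + b (t + T) = U (t + T) x + κ + (b (t + T) - κ)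
    abel

end TypeIliouvilleL.WeakAncientDriftMild

open TypeIliouvilleL.WeakAncientDriftMild in
/-- **Stub A (ancient drift-mild decomposition of print's class, local bounds).** A bounded
ancient mild solution (`ν = 1`, duality form) which is jointly strongly measurable is a bounded
weak solution on `ℝ³ × (−∞,0)` (`IsBoundedAncientMildSolution.isBoundedWeakNSSolutionOn`), hence
(KNSS 2009 Lemma 3.1 = `KNSS2009_weak_driftMild_holds` on the windows `(−(n+1), 0)`, normalised,
`window_decomposition`; glued by Remark 3.1, `overlap_eq`: the normalised window pairs agree on
common windows) `u(t) = U(t) + b(t)` a.e. in `x` for a.e. `t < 0`, with `U(t) = V_{⌊−t⌋}(t)`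
jointly measurable and continuous on `(−∞,0) × ℝ³`, weakly divergence free at every `t < 0`,
`U, b` bounded on every window `(T, 0)`, and the drift-mild identity
`U(t) = e^{(t−s)Δ}U(s) − ∫ₛᵗ e^{(t−σ)Δ}P∇·((U+b)⊗(U+b)) dσ` for all `s < t < 0` (that of the window
`⌊−s⌋`, whose drift-Duhamel term is that of `(U, b)` by `driftDuhamel_congr_ae`). -/
theorem stub_weak_ancient_driftMild :
    ∀ u : ℝ → EuclideanSpace ℝ (Fin 3) → EuclideanSpace ℝ (Fin 3),
      Literature.Analysis.FluidPDE.IsBoundedAncientMildSolution 1 u →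
      StronglyMeasurable (uncurry u) →
      ∃ (U : ℝ → EuclideanSpace ℝ (Fin 3) → EuclideanSpace ℝ (Fin 3))
        (b : ℝ → EuclideanSpace ℝ (Fin 3)),
        Measurable (uncurry U) ∧ Measurable b ∧
        ContinuousOn (uncurry U) (Iio 0 ×ˢ univ) ∧
        (∀ T : ℝ, T < 0 → ∃ N : ℝ,
          (∀ t ∈ Ioo T 0, ∀ x, ‖U t x‖ ≤ N) ∧ ∀ t ∈ Ioo T 0, ‖b t‖ ≤ N) ∧
        (∀ t < 0, Literature.Analysis.FluidPDE.IsWeaklyDivFree (U t)) ∧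
        (∀ s t : ℝ, s < t → t < 0 → ∀ x,
          U t x = Literature.Analysis.UnboundedOperators.heatExtension (U s) (t - s) x -
            Literature.Analysis.FluidPDE.driftDuhamel U b s t x) ∧
        ∀ᵐ t ∂(volume.restrict (Iio (0 : ℝ))), u t =ᵐ[volume] fun x => U t x + b t := by
  intro u hu hj
  -- ## `u` is a bounded weak solution on `(−∞, 0)`; the normalised window pairs `(V_n, β_n)`
  obtain ⟨M, hM⟩ := hu.2
  have hbw : IsBoundedWeakNSSolutionOn (Iio 0) isOpen_Iio 1 u :=
    hu.isBoundedWeakNSSolutionOn one_pos hj.aestronglyMeasurable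
      (fun t _ => (hj.comp_measurable measurable_prodMk_left).aestronglyMeasurable)
  have hwin := fun n : ℕ => window_decomposition hbw hM (T := (n : ℝ) + 1)
    (by have : (0 : ℝ) ≤ n := n.cast_nonneg; linarith)
  choose Nw V β hN0 hVm hβm hVc hVN hβN hdiv hmild hzero hae using hwin
  -- ## the window pairs agree on common windows (Remark 3.1)
  have hagree : ∀ n m : ℕ, n ≤ m → ∀ t ∈ Ioo (-((n : ℝ) + 1)) 0, ∀ x, V m t x = V n t x := by
    intro n m hnm
    have hnm' : -((m : ℝ) + 1) ≤ -((n : ℝ) + 1) := by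
      have : (n : ℝ) ≤ m := Nat.cast_le.2 hnm
      linarith
    have ht₀ : (-(1 / 2) : ℝ) ∈ Ioo (-((n : ℝ) + 1)) 0 :=
      ⟨by have : (0 : ℝ) ≤ n := n.cast_nonneg; linarith, by norm_num⟩
    refine overlap_eq (hVc n) ((hVc m).mono (prod_mono (Ioo_subset_Ioo_left hnm') Subset.rfl))
      (hVN n) (hmild n) (fun s t hs hst ht x => hmild m s t (hnm'.trans_lt hs) hst ht x) ?_ ht₀
      (by rw [hzero n, hzero m])
    have h' := ae_restrict_of_ae_restrict_of_subset (Ioo_subset_Ioo_left hnm') (hae m)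
    filter_upwards [hae n, h'] with t h1 h2
    exact h1.symm.trans h2
  -- ## the selection `ι(t) = ⌊−t⌋`
  set ι : ℝ → ℕ := fun t => ⌊-t⌋₊ with hι
  have hιm : Measurable ι := Nat.measurable_floor.comp measurable_neg
  have hmem : ∀ t : ℝ, t < 0 → t ∈ Ioo (-((ι t : ℝ) + 1)) 0 := fun t ht => by
    have h1 : -t < (ι t : ℝ) + 1 := Nat.lt_floor_add_one (-t)
    exact ⟨by linarith, ht⟩
  have hle : ∀ n : ℕ, ∀ t ∈ Ioo (-((n : ℝ) + 1)) 0, ι t ≤ n := by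
    intro n t ht
    have h1 : (ι t : ℝ) ≤ -t := Nat.floor_le (by linarith [ht.2])
    have h2 : (ι t : ℝ) < n + 1 := by linarith [ht.1]
    have h3 : ι t < n + 1 := by exact_mod_cast h2
    omega
  have hU : ∀ n : ℕ, ∀ t ∈ Ioo (-((n : ℝ) + 1)) 0, ∀ x, V (ι t) t x = V n t x :=
    fun n t ht x => (hagree (ι t) n (hle n t ht) t (hmem t ht.2) x).symm
  -- ## `u = U + b` a.e.
  have hglue : ∀ᵐ t ∂(volume.restrict (Iio (0 : ℝ))),
      u t =ᵐ[volume] fun x => V (ι t) t x + β (ι t) t := by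
    have hall : ∀ᵐ t ∂(volume : Measure ℝ), ∀ n : ℕ, t ∈ Ioo (-((n : ℝ) + 1)) 0 →
        u t =ᵐ[volume] fun x => V n t x + β n t := by
      rw [ae_all_iff]
      exact fun n => (ae_restrict_iff' measurableSet_Ioo).1 (hae n)
    rw [ae_restrict_iff' measurableSet_Iio]
    filter_upwards [hall] with t ht htneg
    exact ht (ι t) (hmem t htneg)
  refine ⟨fun t x => V (ι t) t x, fun t => β (ι t) t, measurable_uncurry_glue (Uw := V) hVm hιm,
    measurable_glue (bw := β) hβm hιm, ?_, ?_, fun t ht => hdiv (ι t) t (hmem t ht), ?_, hglue⟩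
  · -- joint continuity on `(−∞, 0) × ℝ³`: locally the glued field is a window field
    rintro ⟨t, x⟩ ⟨ht, -⟩
    have ht0 : t < 0 := ht
    have hc : ContinuousOn (uncurry fun s y => V (ι s) s y) (Ioo (-((ι t : ℝ) + 1)) 0 ×ˢ univ) :=
      (hVc (ι t)).congr fun q hq => hU (ι t) q.1 hq.1 q.2
    exact (hc.continuousAt
      ((isOpen_Ioo.prod isOpen_univ).mem_nhds ⟨hmem t ht0, mem_univ _⟩)).continuousWithinAt
  · -- local bounds on `(T, 0)`
    intro T hT
    have hTW : -((ι T : ℝ) + 1) < T := (hmem T hT).1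
    refine ⟨∑ k ∈ Finset.range (ι T + 1), Nw k, fun t ht x => ?_, fun t ht => ?_⟩
    · have htW : t ∈ Ioo (-((ι T : ℝ) + 1)) 0 := ⟨hTW.trans ht.1, ht.2⟩
      show ‖V (ι t) t x‖ ≤ _
      rw [hU (ι T) t htW x]
      exact (hVN (ι T) t htW x).trans
        (Finset.single_le_sum (fun k _ => hN0 k) (Finset.mem_range.2 (Nat.lt_succ_self _)))
    · have htW : t ∈ Ioo (-((ι T : ℝ) + 1)) 0 := ⟨hTW.trans ht.1, ht.2⟩
      exact (hβN (ι t) t).trans (Finset.single_le_sum (fun k _ => hN0 k)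
        (Finset.mem_range.2 (Nat.lt_succ_of_le (hle (ι T) t htW))))
  · -- the drift-mild identity between any `s < t < 0`
    intro s t hst ht0 x
    have hsW : s ∈ Ioo (-((ι s : ℝ) + 1)) 0 := hmem s (hst.trans ht0)
    have htW : t ∈ Ioo (-((ι s : ℝ) + 1)) 0 := ⟨hsW.1.trans hst, ht0⟩
    have hD : driftDuhamel (fun τ y => V (ι τ) τ y) (fun τ => β (ι τ) τ) s t x =
        driftDuhamel (V (ι s)) (β (ι s)) s t x := by
      refine driftDuhamel_congr_ae hst.le ?_ x
      have hsub1 : Ioo s t ⊆ Iio 0 := fun σ hσ => (hσ.2.trans ht0 : σ < 0)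
      have hsub : Ioo s t ⊆ Ioo (-((ι s : ℝ) + 1)) 0 := fun σ hσ =>
        ⟨hsW.1.trans hσ.1, hσ.2.trans ht0⟩
      filter_upwards [ae_restrict_of_ae_restrict_of_subset hsub1 hglue,
        ae_restrict_of_ae_restrict_of_subset hsub (hae (ι s))] with σ h1σ h2σ
      exact h1σ.symm.trans h2σ
    have hUs : (fun y => V (ι s) s y) = V (ι s) s := rfl
    show V (ι t) t x = UnboundedOperators.heatExtension (fun y => V (ι s) s y) (t - s) x -
      driftDuhamel (fun τ y => V (ι τ) τ y) (fun τ => β (ι τ) τ) s t x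
    rw [hU (ι s) t htW x, hUs, hD]
    exact hmild (ι s) s t hsW.1 hst ht0 x

end Summit.NavierStokesRegularity.NavierStokesRegularity.Theorems

end
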